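import Literature.IUT.LogVolume.DifferentConductorTowerBounds
import Literature.IUT.LogVolume.DistinguishedPrimesBound
import Literature.NumberTheory.NumberFields.RelativeDifferentExponentsTower
import HarnessLib

/-!
# [IUTchIV] Theorem 1.10, Step (ii), for REAL towers of number fields, III: the THREE-field tower
# `F_tpd ⊆ F ⊆ K` read directly from `F_tpd` to `K`, with the printed constant `log(2^11·3^3·5^2) + 2·log(l)`

Mochizuki, *Inter-universal Teichmüller theory IV*, RIMS manuscript (Apr. 2020; = PRIMS **57** (2021)),
Theorem 1.10, proof Step (ii), p. 24 (kurims `paper:url-56bcb0f95768`, read on the page):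

> "the inequality `log(𝔡^F) + log(𝔣^F) ≤ log(𝔡^{F_tpd}) + log(𝔣^{F_tpd}) + log(2^11·3^3·5^2)` follows by
> applying Proposition 1.3, (i), at the primes that do not divide `2·3·5` [where we recall that the extension
> `F/F_tpd` is tamely ramified over such primes — cf. Proposition 1.8, (vi), (vii)] and applying Proposition
> 1.3, (ii), together with (E3), (E4), (E5), (E6), and the fact that we have a natural outer inclusion
> `Gal(F/F_tpd) ↪ GL_2(𝔽_3) × GL_2(𝔽_5) × ℤ/2ℤ`, at the primes that divide `2·3·5`. In a similar vein, since the
> extension `K/F` is tamely ramified at the primes that do not divide `l`, and we have a natural outer inclusion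
> `Gal(K/F) ↪ GL_2(𝔽_l)`, the inequality `log(𝔡^K) ≤ log(𝔡^K) + log(𝔣^K) ≤ log(𝔡^F) + log(𝔣^F) + 2·log(l)
> ≤ log(𝔡^{F_tpd}) + log(𝔣^{F_tpd}) + 2·log(l) + 21` follows immediately from Proposition 1.3, (i), (ii)."

Sequel of `DifferentConductorTower(Bounds).lean` (two-field towers). WHY A THREE-FIELD FORM (cell abc-iut,
finding F-Sd1g3-1 of abc-iut-S-d1, second read abc-iut-L5-t15, 2026-08-26): Theorem 1.10 allows `E_F` to
have bad reduction at places dividing `2l` outside `𝕍^bad` (statement p. 22; Cor. 2.2 (P3), p. 45), and at a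
bad place over `l` the extension `F/F_tpd = F_tpd(√−1, E[3·5])/F_tpd` is tamely RAMIFIED (`15 ∣ e`) while
`l ∉ Supp(𝔣)`: the `F`-LEVEL display `log(𝔡^F) + log(𝔣^F) ≤ log(𝔡^{F_tpd}) + log(𝔣^{F_tpd}) +
log(2^11·3^3·5^2)` then fails by an uncompensated `(1 − 1/e)·log(l)`-sized term and is NOT derivable from the
hypotheses. The `K`-LEVEL chain — which is all that Steps (iii), (viii) consume — survives with the PRINTED
constants when Prop. 1.3 (ii) is applied from `F_tpd` straight to `K`: over `2·3·5` the Galois layer is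
`F/F_tpd` (`[F:F_tpd] ∣ 2^{10}·3^2·5`) with the TAME layer `K/F` on top (`l ∤ 2·3·5`); over `l` the Galois
layer is `K/F` (`[K:F] ∣ |GL₂(𝔽_l)|`, `v_l = 1`) over the TAME layer `F/F_tpd` (`l ∤ 2^{10}·3^2·5`) — the
tame layers cost nothing in the `c(p)·e(u|p)` accounting (per-prime lemmas
`Literature.NumberTheory.NumberFields.multiplicity_differentIdeal_tower_succ_le_of_not_dvd_top/_bot`).

PROVED here, for ACTUAL number fields `F₀ ⊆ F ⊆ K` (`F₀` = "`F_tpd`"), bad places `S₀` of `F₀`, `T` the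
places of `K` over `S₀`:
* `ndeg_different_add_reduced_le_tower` — general form with two disjoint exceptional prime sets `P₁`
  (`K/F` tame, `F/F₀` Galois of degree `∣ M`) and `P₂` (`F/F₀` tame, `K/F` Galois of degree `∣ N`):
  `deg(𝔡^K) + deg(𝔣^K) ≤ deg(𝔡^{F₀}) + deg(𝔣^{F₀}) + Σ_{P₁}(v_p M + 1)·log p + Σ_{P₂}(v_p N + 1)·log p`
  (bounds `m₁`, `m₂` on the valuations), under: `K/F` and `F/F₀` unramified at the good and tame at the bad
  places of residue characteristic `∉ P₁ ∪ P₂`;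
* `ndeg_different_add_reduced_le_theta` — the [IUTchIV] instance `P₁ = {2,3,5}`, `M = 2^{10}·3^2·5`
  (`= |GL₂(𝔽₃)|·|GL₂(𝔽₅)|·2`, (E3)(E4)(E5)), `P₂ = {l}`, `N = l·(l−1)²·(l+1) = |GL₂(𝔽_l)|`, `l ≥ 7` prime:
  **`deg(𝔡^K_ADiv) + deg(𝔣^K_ADiv) ≤ deg(𝔡^{F_tpd}_ADiv) + deg(𝔣^{F_tpd}_ADiv) + log(2^11·3^3·5^2) + 2·log(l)`**
  — the composite of the printed second and third displays, i.e. what `Thm110Numerics.ProofData.F_le ∘ K_le`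
  deliver to Step (iii), for actual number fields; its hypotheses are exactly the (D0)-type ramification facts
  (good ⇒ unramified, bad multiplicative ⇒ tame; tame above `2·3·5` for `K/F`, above `l` and away from `2·3·5`
  for `F/F_tpd`) and the two Galois/degree facts, which abc-iut-S-d1 proves for the genuine theta tower.

What remains HYPOTHESIS is what the printed proof takes from Prop. 1.8 (vi)(vii) / (D0) and from the Galois
groups. No log-volume computation and no statement of [IUTchIII] is involved; nothing here takes a side on
Cor. 3.12; classical algebraic number theory kernel-checked, the [IUTchIV] locators recording what it
instantiates.
-/

noncomputable section

namespace Literature.IUT.LogVolume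

open NumberField IsDedekindDomain Finset
open Literature.NumberTheory.NumberFields (multiplicity_differentIdeal_tower_succ_le_of_not_dvd_top
  multiplicity_differentIdeal_tower_succ_le_of_not_dvd_bot ramificationIdx_rel_eq_one_of_eq_one_of_eq_one
  not_dvd_ramificationIdx_rel_of_not_dvd_of_not_dvd)
open scoped Classical

variable (F₀ F K : Type*) [Field F₀] [NumberField F₀] [Field F] [NumberField F] [Field K] [NumberField K]
  [Algebra F₀ F] [Algebra F K] [Algebra F₀ K] [IsScalarTower F₀ F K]

/-! ### Places in the tower -/

omit [NumberField F₀] [NumberField F] [NumberField K] in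
/-- The place of `F₀` under a place of `K` is the place under the place of `F` under it
(`(u ∩ 𝓞 F) ∩ 𝓞 F₀ = u ∩ 𝓞 F₀`). [cite: Mochizuki2012, IUTchIV Def. 1.9 (ii) p. 22] -/
theorem finBelow_finBelow (u : HeightOneSpectrum (𝓞 K)) :
    finBelow F₀ F (finBelow F K u) = finBelow F₀ K u :=
  HeightOneSpectrum.ext (Ideal.under_under (B := 𝓞 F) u.asIdeal)

omit [NumberField F₀] [NumberField F] [NumberField K] [Algebra F₀ F] [Algebra F₀ K] [IsScalarTower F₀ F K] in
/-- The ideal of the place of `F` under `u` is `u ∩ 𝓞 F`. [cite: Mochizuki2012, IUTchIV Def. 1.9 (ii) p. 22] -/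
theorem finBelow_asIdeal (u : HeightOneSpectrum (𝓞 K)) :
    (finBelow F K u).asIdeal = u.asIdeal.under (𝓞 F) := rfl

/-- `v_p(N) ≤ m` from `p^{m+1} ∤ N`. [cite: NeukirchANT1999, Ch. I (8.2)] -/
private theorem factorization_le_of_not_pow_dvd' {p N m : ℕ} (hp : p.Prime) (hN : N ≠ 0)
    (h : ¬ p ^ (m + 1) ∣ N) : N.factorization p ≤ m := by
  by_contra hlt
  exact h ((hp.pow_dvd_iff_le_factorization hN).mpr (by omega))

/-! ### The three-field form of Step (ii), second and third displays composed -/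

/-- **[IUTchIV] Thm. 1.10, Step (ii), three-field form (general constants).** Number fields `F₀ ⊆ F ⊆ K`
with `F/F₀` Galois, `[F:F₀] ∣ M`, and `K/F` Galois, `[K:F] ∣ N`; bad places `S₀` of `F₀`, `T` = the places of
`K` over `S₀`; disjoint finite sets of rational primes `P₁`, `P₂` with `v_p(M) ≤ m₁(p)` on `P₁` and
`v_p(N) ≤ m₂(p)` on `P₂`. Hypotheses (the (D0)-type inputs): both layers are unramified at the places not
over `S₀` and tamely ramified at the places over `S₀` whenever the residue characteristic is `∉ P₁ ∪ P₂`;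
`K/F` is tame above `P₁`; `F/F₀` is tame above `P₂`. Conclusion:
`deg(𝔡^K_ADiv) + deg(𝔣^K_ADiv) ≤ deg(𝔡^{F₀}_ADiv) + deg(𝔣^{F₀}_ADiv) + Σ_{p∈P₁}(m₁ p + 1)·log p +
Σ_{p∈P₂}(m₂ p + 1)·log p` — Prop. 1.3 (i) at the tame places (the relative different `e − 1` exactly pays the
reduced conductor's loss, composed along the tower), Prop. 1.3 (ii) from `F₀` to `K` over `P₁` (Galois bottom,
tame top) and over `P₂` (tame bottom, Galois top). [claim: Mochizuki2012, status: disputed] -/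
theorem ndeg_different_add_reduced_le_tower [IsGalois F₀ F] [IsGalois F K]
    (S₀ : Finset (HeightOneSpectrum (𝓞 F₀)))
    (T : Finset (HeightOneSpectrum (𝓞 K))) (hT : ∀ u, u ∈ T ↔ finBelow F₀ K u ∈ S₀)
    (P₁ P₂ : Finset ℕ) (hP₁ : ∀ p ∈ P₁, p.Prime) (hP₂ : ∀ p ∈ P₂, p.Prime) (hdisj : Disjoint P₁ P₂)
    {M N : ℕ} (hM : M ≠ 0) (hN : N ≠ 0) (hdvdM : Module.finrank F₀ F ∣ M) (hdvdN : Module.finrank F K ∣ N)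
    (m₁ m₂ : ℕ → ℕ) (hm₁ : ∀ p ∈ P₁, M.factorization p ≤ m₁ p) (hm₂ : ∀ p ∈ P₂, N.factorization p ≤ m₂ p)
    (hKunr : ∀ u : HeightOneSpectrum (𝓞 K), residueChar K u ∉ P₁ ∪ P₂ → finBelow F₀ K u ∉ S₀ →
      u.asIdeal.ramificationIdx (𝓞 F) = 1)
    (hKtame : ∀ u : HeightOneSpectrum (𝓞 K), residueChar K u ∉ P₁ ∪ P₂ → finBelow F₀ K u ∈ S₀ →
      ¬ residueChar K u ∣ u.asIdeal.ramificationIdx (𝓞 F))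
    (hKtop : ∀ u : HeightOneSpectrum (𝓞 K), residueChar K u ∈ P₁ →
      ¬ residueChar K u ∣ u.asIdeal.ramificationIdx (𝓞 F))
    (hFunr : ∀ w : HeightOneSpectrum (𝓞 F), residueChar F w ∉ P₁ ∪ P₂ → finBelow F₀ F w ∉ S₀ →
      w.asIdeal.ramificationIdx (𝓞 F₀) = 1)
    (hFtame : ∀ w : HeightOneSpectrum (𝓞 F), residueChar F w ∉ P₁ ∪ P₂ → finBelow F₀ F w ∈ S₀ →
      ¬ residueChar F w ∣ w.asIdeal.ramificationIdx (𝓞 F₀))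
    (hFbot : ∀ w : HeightOneSpectrum (𝓞 F), residueChar F w ∈ P₂ →
      ¬ residueChar F w ∣ w.asIdeal.ramificationIdx (𝓞 F₀)) :
    ndeg K (differentDivisor K) + ndeg K (ADivisor.reduced T) ≤
      ndeg F₀ (differentDivisor F₀) + ndeg F₀ (ADivisor.reduced S₀) +
        (∑ p ∈ P₁, ((m₁ p + 1 : ℕ) : ℝ) * Real.log p + ∑ p ∈ P₂, ((m₂ p + 1 : ℕ) : ℝ) * Real.log p) := by
  have hP : ∀ p ∈ P₁ ∪ P₂, p.Prime := fun p hp =>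
    (Finset.mem_union.mp hp).elim (hP₁ p) (hP₂ p)
  -- the residue characteristic and the place below, seen from `F`
  have hres : ∀ u : HeightOneSpectrum (𝓞 K), residueChar F (finBelow F K u) = residueChar K u :=
    fun u => residueChar_finBelow (F := F) u
  have hbel : ∀ u : HeightOneSpectrum (𝓞 K), finBelow F₀ F (finBelow F K u) = finBelow F₀ K u :=
    fun u => finBelow_finBelow F₀ F K u
  have key := ndeg_different_add_reduced_le F₀ K S₀ T hT (P₁ ∪ P₂) hP
    (fun p => if p ∈ P₁ then m₁ p + 1 else m₂ p + 1) ?_ ?_ ?_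
  · -- split the sum over the disjoint union
    have hsum : ∑ p ∈ P₁ ∪ P₂, (((if p ∈ P₁ then m₁ p + 1 else m₂ p + 1 : ℕ)) : ℝ) * Real.log p =
        ∑ p ∈ P₁, ((m₁ p + 1 : ℕ) : ℝ) * Real.log p + ∑ p ∈ P₂, ((m₂ p + 1 : ℕ) : ℝ) * Real.log p := by
      rw [Finset.sum_union hdisj]
      congr 1
      · exact Finset.sum_congr rfl fun p hp => by rw [if_pos hp]
      · exact Finset.sum_congr rfl fun p hp => by
          rw [if_neg (Finset.disjoint_right.mp hdisj hp)]
    rwa [hsum] at key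
  · -- unramified over unramified
    intro u hp hS
    haveI : u.asIdeal.IsMaximal := u.isMaximal
    refine ramificationIdx_rel_eq_one_of_eq_one_of_eq_one F₀ F K u.asIdeal (hKunr u hp hS) ?_
    rw [← finBelow_asIdeal F K u]
    exact hFunr (finBelow F K u) (by rwa [hres u]) (by rwa [hbel u])
  · -- tame over tame
    intro u hp hS
    haveI : u.asIdeal.IsMaximal := u.isMaximal
    refine not_dvd_ramificationIdx_rel_of_not_dvd_of_not_dvd F₀ F K u.asIdeal (residueChar_prime K u)
      (hKtame u hp hS) ?_
    rw [← finBelow_asIdeal F K u, ← hres u]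
    exact hFtame (finBelow F K u) (by rwa [hres u]) (by rwa [hbel u])
  · -- Prop. 1.3 (ii) from `F₀` straight to `K` over `P₁ ∪ P₂`
    intro u hp
    haveI : u.asIdeal.IsMaximal := u.isMaximal
    rcases Finset.mem_union.mp hp with hp1 | hp2
    · -- `p ∈ P₁`: `K/F` tame on top of the Galois layer `F/F₀`
      rw [if_pos hp1]
      have h := multiplicity_differentIdeal_tower_succ_le_of_not_dvd_top F₀ F K u.asIdeal hM hdvdM (hKtop u hp1)
      have hm := hm₁ _ hp1
      change multiplicity u.asIdeal _ + 1 ≤ u.asIdeal.ramificationIdx ℤ * (M.factorization (residueChar K u) + 1)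
        at h
      have h2 : u.asIdeal.ramificationIdx ℤ * (M.factorization (residueChar K u) + 1) ≤
          u.asIdeal.ramificationIdx ℤ * (m₁ (residueChar K u) + 1) :=
        Nat.mul_le_mul_left _ (Nat.succ_le_succ hm)
      have := h.trans h2
      rw [mul_comm] at this
      omega
    · -- `p ∈ P₂`: the Galois layer `K/F` on top of `F/F₀`, tame at the place below
      have hp1 : residueChar K u ∉ P₁ := Finset.disjoint_right.mp hdisj hp2
      rw [if_neg hp1]
      have hbot : ¬ residueChar K u ∣ (u.asIdeal.under (𝓞 F)).ramificationIdx (𝓞 F₀) := by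
        rw [← finBelow_asIdeal F K u, ← hres u]
        exact hFbot (finBelow F K u) (by rwa [hres u])
      have h := multiplicity_differentIdeal_tower_succ_le_of_not_dvd_bot F₀ F K u.asIdeal hN hdvdN hbot
      have hm := hm₂ _ hp2
      change multiplicity u.asIdeal _ + 1 ≤ u.asIdeal.ramificationIdx ℤ * (N.factorization (residueChar K u) + 1)
        at h
      have h2 : u.asIdeal.ramificationIdx ℤ * (N.factorization (residueChar K u) + 1) ≤
          u.asIdeal.ramificationIdx ℤ * (m₂ (residueChar K u) + 1) :=
        Nat.mul_le_mul_left _ (Nat.succ_le_succ hm)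
      have := h.trans h2
      rw [mul_comm] at this
      omega

/-- **[IUTchIV] Thm. 1.10, Step (ii), for the tower `F_tpd ⊆ F ⊆ K` with the PRINTED constants**: for number
fields `F₀ ⊆ F ⊆ K` ("`F_tpd ⊆ F ⊆ K`") with `F/F₀` Galois of degree dividing `2^{10}·3^2·5 =
|GL₂(𝔽₃)|·|GL₂(𝔽₅)|·2` ("`Gal(F/F_tpd) ↪ GL₂(𝔽₃) × GL₂(𝔽₅) × ℤ/2ℤ`", (E3)(E4)(E5)) and `K/F` Galois of degree
dividing `l·(l−1)²·(l+1) = |GL₂(𝔽_l)|` ("`Gal(K/F) ↪ GL₂(𝔽_l)`"), `l ≥ 7` prime, bad places `S₀` of `F₀`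
(`T` = the places of `K` over `S₀`), and the (D0)-type ramification facts — both layers unramified at the good
and tame at the bad places of residue characteristic `∤ 2·3·5·l`, `K/F` tame above `2·3·5` ("`K/F` is tamely
ramified at the primes that do not divide `l`"), `F/F₀` tame away from `2·3·5` ("`F/F_tpd` is tamely ramified
over such primes"):
`deg(𝔡^K_ADiv) + deg(𝔣^K_ADiv) ≤ deg(𝔡^{F_tpd}_ADiv) + deg(𝔣^{F_tpd}_ADiv) + log(2^11·3^3·5^2) + 2·log(l)`
— the composite of the printed second and third displays (p. 24), read directly from `F_tpd` to `K` so that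
bad reduction above `2l` (allowed by the statement of Thm. 1.10) is covered. This is the `K`-level input of
Step (iii)/(viii) (`ProofData.F_le ∘ K_le` of `Thm110Numerics`) for ACTUAL number fields.
[claim: Mochizuki2012, status: disputed] -/
theorem ndeg_different_add_reduced_le_theta [IsGalois F₀ F] [IsGalois F K] {l : ℕ} (hl : l.Prime)
    (h7 : 7 ≤ l)
    (S₀ : Finset (HeightOneSpectrum (𝓞 F₀)))
    (T : Finset (HeightOneSpectrum (𝓞 K))) (hT : ∀ u, u ∈ T ↔ finBelow F₀ K u ∈ S₀)
    (hdegF : Module.finrank F₀ F ∣ 2 ^ 10 * 3 ^ 2 * 5)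
    (hdegK : Module.finrank F K ∣ l * (l - 1) ^ 2 * (l + 1))
    (hKunr : ∀ u : HeightOneSpectrum (𝓞 K), residueChar K u ∉ ({2, 3, 5, l} : Finset ℕ) →
      finBelow F₀ K u ∉ S₀ → u.asIdeal.ramificationIdx (𝓞 F) = 1)
    (hKtame : ∀ u : HeightOneSpectrum (𝓞 K), residueChar K u ∉ ({2, 3, 5, l} : Finset ℕ) →
      finBelow F₀ K u ∈ S₀ → ¬ residueChar K u ∣ u.asIdeal.ramificationIdx (𝓞 F))
    (hKtop : ∀ u : HeightOneSpectrum (𝓞 K), residueChar K u ∈ ({2, 3, 5} : Finset ℕ) →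
      ¬ residueChar K u ∣ u.asIdeal.ramificationIdx (𝓞 F))
    (hFunr : ∀ w : HeightOneSpectrum (𝓞 F), residueChar F w ∉ ({2, 3, 5, l} : Finset ℕ) →
      finBelow F₀ F w ∉ S₀ → w.asIdeal.ramificationIdx (𝓞 F₀) = 1)
    (hFtame : ∀ w : HeightOneSpectrum (𝓞 F), residueChar F w ∉ ({2, 3, 5} : Finset ℕ) →
      ¬ residueChar F w ∣ w.asIdeal.ramificationIdx (𝓞 F₀)) :
    ndeg K (differentDivisor K) + ndeg K (ADivisor.reduced T) ≤
      ndeg F₀ (differentDivisor F₀) + ndeg F₀ (ADivisor.reduced S₀) +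
        (Real.log (2 ^ 11 * 3 ^ 3 * 5 ^ 2) + 2 * Real.log l) := by
  have hl2 : l ≠ 2 := by omega
  have hl3 : l ≠ 3 := by omega
  have hl5 : l ≠ 5 := by omega
  have hP₁ : ∀ p ∈ ({2, 3, 5} : Finset ℕ), p.Prime := by
    intro p hp
    simp only [Finset.mem_insert, Finset.mem_singleton] at hp
    rcases hp with rfl | rfl | rfl <;> norm_num
  have hP₂ : ∀ p ∈ ({l} : Finset ℕ), p.Prime := fun p hp => by
    rw [Finset.mem_singleton] at hp; exact hp ▸ hl
  have hdisj : Disjoint ({2, 3, 5} : Finset ℕ) {l} := by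
    rw [Finset.disjoint_singleton_right]
    simp only [Finset.mem_insert, Finset.mem_singleton, not_or]
    exact ⟨hl2, hl3, hl5⟩
  have hunion : ({2, 3, 5} : Finset ℕ) ∪ {l} = {2, 3, 5, l} := by
    ext p; simp only [Finset.mem_union, Finset.mem_insert, Finset.mem_singleton]; tauto
  have hM : (2 ^ 10 * 3 ^ 2 * 5 : ℕ) ≠ 0 := by norm_num
  have hN : l * (l - 1) ^ 2 * (l + 1) ≠ 0 :=
    Nat.mul_ne_zero (Nat.mul_ne_zero hl.ne_zero (pow_ne_zero 2 (by omega))) (Nat.succ_ne_zero l)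
  let m₁ : ℕ → ℕ := fun p => if p = 2 then 10 else if p = 3 then 2 else 1
  have hm₁ : ∀ p ∈ ({2, 3, 5} : Finset ℕ), (2 ^ 10 * 3 ^ 2 * 5 : ℕ).factorization p ≤ m₁ p := by
    intro p hp
    simp only [Finset.mem_insert, Finset.mem_singleton] at hp
    rcases hp with rfl | rfl | rfl
    · exact factorization_le_of_not_pow_dvd' Nat.prime_two hM (by decide)
    · exact factorization_le_of_not_pow_dvd' Nat.prime_three hM (by decide)
    · exact factorization_le_of_not_pow_dvd' (by norm_num) hM (by decide)
  have hm₂ : ∀ p ∈ ({l} : Finset ℕ), (l * (l - 1) ^ 2 * (l + 1)).factorization p ≤ 1 := by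
    intro p hp
    rw [Finset.mem_singleton] at hp
    subst hp
    refine factorization_le_of_not_pow_dvd' hl hN ?_
    have h := (Thm110StepII.PlaceData.GL2_card_l_part p hl (by omega)).2
    rwa [mul_right_comm] at h
  have key := ndeg_different_add_reduced_le_tower F₀ F K S₀ T hT {2, 3, 5} {l} hP₁ hP₂ hdisj hM hN hdegF hdegK
    m₁ (fun _ => 1) hm₁ hm₂
    (fun u hp => hKunr u (by rwa [← hunion])) (fun u hp => hKtame u (by rwa [← hunion])) hKtop
    (fun w hp => hFunr w (by rwa [← hunion]))
    (fun w hp _ => hFtame w (fun h => hp (Finset.mem_union_left _ h)))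
    (fun w hp => hFtame w (fun h => Finset.disjoint_left.mp hdisj h hp))
  have hsum1 : ∑ p ∈ ({2, 3, 5} : Finset ℕ), ((m₁ p + 1 : ℕ) : ℝ) * Real.log p =
      Real.log (2 ^ 11 * 3 ^ 3 * 5 ^ 2) := by
    rw [← Thm110StepII.PlaceData.log_F_const.2, Finset.sum_insert (by decide), Finset.sum_insert (by decide),
      Finset.sum_singleton]
    simp only [m₁]
    push_cast
    ring
  have hsum2 : ∑ p ∈ ({l} : Finset ℕ), (((1 : ℕ) + 1 : ℕ) : ℝ) * Real.log p = 2 * Real.log l := by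
    rw [Finset.sum_singleton]; norm_num
  rwa [hsum1, hsum2] at key

/-- **Step (ii) for `F_tpd ⊆ F ⊆ K` with a PARAMETRIC 2-power in `[F : F_tpd]`**: as
`ndeg_different_add_reduced_le_theta`, but with `[F:F₀] ∣ 2^a·3^2·5` and the constant `log(2^{a+1}·3^3·5^2) + 2·log(l)`
— `a = 10` is print's `F = F_tpd(√−1, E[3·5])` ("`Gal(F/F_tpd) ↪ GL₂(𝔽₃) × GL₂(𝔽₅) × ℤ/2ℤ`", p. 24), `a = 12` the
cell's reading v3 `F‡ = F_tpd(√−1, √λ, √(λ−1), E_λ[3·5])` (abc-iut-plan 2026-08-26T02:33:05Z; `[F‡:F_tpd] ∣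
8·|GL₂(𝔽₃)|·|GL₂(𝔽₅)|`): `log(2^{13}·3^3·5^2) ≈ 12.75 ≤ 21`, so the printed next line "`≤ … + 2·log(l) + 21`" and
everything downstream are unaffected. [claim: Mochizuki2012, status: disputed] -/
theorem ndeg_different_add_reduced_le_theta_pow [IsGalois F₀ F] [IsGalois F K] {l : ℕ} (hl : l.Prime)
    (h7 : 7 ≤ l) (a : ℕ)
    (S₀ : Finset (HeightOneSpectrum (𝓞 F₀)))
    (T : Finset (HeightOneSpectrum (𝓞 K))) (hT : ∀ u, u ∈ T ↔ finBelow F₀ K u ∈ S₀)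
    (hdegF : Module.finrank F₀ F ∣ 2 ^ a * 3 ^ 2 * 5)
    (hdegK : Module.finrank F K ∣ l * (l - 1) ^ 2 * (l + 1))
    (hKunr : ∀ u : HeightOneSpectrum (𝓞 K), residueChar K u ∉ ({2, 3, 5, l} : Finset ℕ) →
      finBelow F₀ K u ∉ S₀ → u.asIdeal.ramificationIdx (𝓞 F) = 1)
    (hKtame : ∀ u : HeightOneSpectrum (𝓞 K), residueChar K u ∉ ({2, 3, 5, l} : Finset ℕ) →
      finBelow F₀ K u ∈ S₀ → ¬ residueChar K u ∣ u.asIdeal.ramificationIdx (𝓞 F))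
    (hKtop : ∀ u : HeightOneSpectrum (𝓞 K), residueChar K u ∈ ({2, 3, 5} : Finset ℕ) →
      ¬ residueChar K u ∣ u.asIdeal.ramificationIdx (𝓞 F))
    (hFunr : ∀ w : HeightOneSpectrum (𝓞 F), residueChar F w ∉ ({2, 3, 5, l} : Finset ℕ) →
      finBelow F₀ F w ∉ S₀ → w.asIdeal.ramificationIdx (𝓞 F₀) = 1)
    (hFtame : ∀ w : HeightOneSpectrum (𝓞 F), residueChar F w ∉ ({2, 3, 5} : Finset ℕ) →
      ¬ residueChar F w ∣ w.asIdeal.ramificationIdx (𝓞 F₀)) :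
    ndeg K (differentDivisor K) + ndeg K (ADivisor.reduced T) ≤
      ndeg F₀ (differentDivisor F₀) + ndeg F₀ (ADivisor.reduced S₀) +
        (Real.log (2 ^ (a + 1) * 3 ^ 3 * 5 ^ 2) + 2 * Real.log l) := by
  have hl2 : l ≠ 2 := by omega
  have hl3 : l ≠ 3 := by omega
  have hl5 : l ≠ 5 := by omega
  have hP₁ : ∀ p ∈ ({2, 3, 5} : Finset ℕ), p.Prime := by
    intro p hp
    simp only [Finset.mem_insert, Finset.mem_singleton] at hp
    rcases hp with rfl | rfl | rfl <;> norm_num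
  have hP₂ : ∀ p ∈ ({l} : Finset ℕ), p.Prime := fun p hp => by
    rw [Finset.mem_singleton] at hp; exact hp ▸ hl
  have hdisj : Disjoint ({2, 3, 5} : Finset ℕ) {l} := by
    rw [Finset.disjoint_singleton_right]
    simp only [Finset.mem_insert, Finset.mem_singleton, not_or]
    exact ⟨hl2, hl3, hl5⟩
  have hunion : ({2, 3, 5} : Finset ℕ) ∪ {l} = {2, 3, 5, l} := by
    ext p; simp only [Finset.mem_union, Finset.mem_insert, Finset.mem_singleton]; tauto
  have hM : (2 ^ a * 3 ^ 2 * 5 : ℕ) ≠ 0 := by positivity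
  have hN : l * (l - 1) ^ 2 * (l + 1) ≠ 0 :=
    Nat.mul_ne_zero (Nat.mul_ne_zero hl.ne_zero (pow_ne_zero 2 (by omega))) (Nat.succ_ne_zero l)
  let m₁ : ℕ → ℕ := fun p => if p = 2 then a else if p = 3 then 2 else 1
  have hm₁ : ∀ p ∈ ({2, 3, 5} : Finset ℕ), (2 ^ a * 3 ^ 2 * 5 : ℕ).factorization p ≤ m₁ p := by
    have e45 : (2 ^ a * 3 ^ 2 * 5 : ℕ) = 45 * 2 ^ a := by ring
    intro p hp
    simp only [Finset.mem_insert, Finset.mem_singleton] at hp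
    rcases hp with rfl | rfl | rfl
    · -- `v_2 = a`
      refine factorization_le_of_not_pow_dvd' Nat.prime_two hM fun h => ?_
      rw [e45, pow_succ, mul_comm 45] at h
      have h2 : 2 ∣ 45 := (Nat.mul_dvd_mul_iff_left (pow_pos two_pos a)).mp h
      omega
    · -- `v_3 = 2`
      refine factorization_le_of_not_pow_dvd' Nat.prime_three hM fun h => ?_
      rw [e45] at h
      have h3 : 3 ^ (2 + 1) ∣ 45 :=
        (Nat.Coprime.pow 3 a (by norm_num : Nat.Coprime 3 2)).dvd_of_dvd_mul_right h
      norm_num at h3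
    · -- `v_5 = 1`
      refine factorization_le_of_not_pow_dvd' (by norm_num) hM fun h => ?_
      rw [e45] at h
      have h5 : 5 ^ (1 + 1) ∣ 45 :=
        (Nat.Coprime.pow 2 a (by norm_num : Nat.Coprime 5 2)).dvd_of_dvd_mul_right h
      norm_num at h5
  have hm₂ : ∀ p ∈ ({l} : Finset ℕ), (l * (l - 1) ^ 2 * (l + 1)).factorization p ≤ 1 := by
    intro p hp
    rw [Finset.mem_singleton] at hp
    subst hp
    refine factorization_le_of_not_pow_dvd' hl hN ?_
    have h := (Thm110StepII.PlaceData.GL2_card_l_part p hl (by omega)).2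
    rwa [mul_right_comm] at h
  have key := ndeg_different_add_reduced_le_tower F₀ F K S₀ T hT {2, 3, 5} {l} hP₁ hP₂ hdisj hM hN hdegF hdegK
    m₁ (fun _ => 1) hm₁ hm₂
    (fun u hp => hKunr u (by rwa [← hunion])) (fun u hp => hKtame u (by rwa [← hunion])) hKtop
    (fun w hp => hFunr w (by rwa [← hunion]))
    (fun w hp _ => hFtame w (fun h => hp (Finset.mem_union_left _ h)))
    (fun w hp => hFtame w (fun h => Finset.disjoint_left.mp hdisj h hp))
  have hsum1 : ∑ p ∈ ({2, 3, 5} : Finset ℕ), ((m₁ p + 1 : ℕ) : ℝ) * Real.log p =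
      Real.log (2 ^ (a + 1) * 3 ^ 3 * 5 ^ 2) := by
    rw [Finset.sum_insert (by decide), Finset.sum_insert (by decide), Finset.sum_singleton]
    simp only [m₁]
    rw [Real.log_mul (by positivity) (by norm_num), Real.log_mul (by positivity) (by norm_num),
      Real.log_pow, Real.log_pow, Real.log_pow]
    push_cast
    ring
  have hsum2 : ∑ p ∈ ({l} : Finset ℕ), (((1 : ℕ) + 1 : ℕ) : ℝ) * Real.log p = 2 * Real.log l := by
    rw [Finset.sum_singleton]; norm_num
  rwa [hsum1, hsum2] at key

end Literature.IUT.LogVolume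

end
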